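import Mathlib
import Literature.NumberTheory.LFunctions.MertensElementary
import HarnessLib

/-!
# Route `IntegerScrew` — the `1/L` Poincaré inequality for the truncated multiplicative walk (PROP. 24.7)

CONTINUUM-LIMIT §24.7 in the kernel.  `IntegerScrewWalkPoincareWeak` bounded the harmonic mass of the users of
an edge `y → y / minFac y` of the smallest-prime tree by the mass `(1 + log M)/y` of ALL multiples of `y`
(a `1/L²` gap bound).  Here the users are counted exactly — `x` uses the edge at `y` iff `y ∣ x` and `x / y` is
`minFac y`-smooth — and weighed by the Euler product over smooth numbers
(`EulerProduct.summable_and_hasSum_smoothNumbers_prod_primesBelow_geometric`):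
* `sq_sub_le_cardFactors_mul_sum_path` — `(g x − g 1)² ≤ Ω(x) · Σ_{y on the path of x} (g y − g(y/minFac y))²`;
* `sum_inv_smooth_le_prod` — `Σ_{m ≤ X, m N-smooth} 1/m ≤ ∏_{p < N} (1 − 1/p)⁻¹`;
* `sum_inv_path_users_le` — `Σ_{x ≤ M : y on the path of x} 1/x ≤ (1/y) ∏_{q ≤ minFac y} (1 − 1/q)⁻¹`;
* **`walk_poincare_mertens`** — `Σ_{x ≤ M} (1/x)(g x − g 1)² ≤ ⌊log₂ M⌋ Σ_{2 ≤ y ≤ M} π(minFac y) (1/y)(g y − g(y/minFac y))²`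
  with `π(p) = ∏_{q ≤ p}(1 − 1/q)⁻¹`;
* **`walk_poincare_mertens_dirichlet`** — if `π(p) ≤ C log p` for the primes `p ≤ M` (Mertens; the best constant is
  `2/log 2`, at `p = 2`) then `Σ_{x ≤ M} (1/x)(g x − g 1)² ≤ ⌊log₂ M⌋ · C · D(g)`,
  `D(g) = Σ_{x ≤ M}(1/x) Σ_{n ∣ x} Λ(n)(g x − g(x/n))²` the unnormalised t-time Dirichlet form;
* **`walk_poincare_mertens_dirichlet_exp_five`** — unconditionally with `C = e⁵`
  (`Literature.NumberTheory.LFunctions.MertensBound.exp_neg_div_log_le_prod_one_sub_inv`).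
Hence every non-zero eigenvalue of `−ℒ_M` is `≥ 1/(C ⌊log₂ M⌋)` in t-units: the `1/L` bound of PROP. 24.7.
RH-free, elementary.  References: CONTINUUM-LIMIT §24.7/§24.9 (rh-explicit A6-PIVOT); M. Suzuki, J. Lond. Math.
Soc. (2) 108 (2023) 1448–1487 [Suzuki2023]; Hardy–Wright, Thm 429 [HardyWright2008].
-/

noncomputable section

set_option linter.dupNamespace false -- D-0017: `Summit.<S>.<S>.…` is the designed namespace

namespace Summit.RiemannHypothesis.RiemannHypothesis.Theorems.IntegerScrew

open Finset ArithmeticFunction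
open scoped ArithmeticFunction.Omega

/-! ### The smallest-prime step (private copies of `IntegerScrewWalkPoincareWeak`'s lemmas: no farm olean yet) -/

/-- `Ω(x) = Ω(x / minFac x) + 1` for `x ≥ 2`. -/
private theorem cardFactors_div_minFac' {x : ℕ} (hx : 2 ≤ x) : Ω (x / x.minFac) + 1 = Ω x := by
  obtain ⟨n, rfl⟩ : ∃ n, x = n + 2 := ⟨x - 2, by omega⟩
  rw [cardFactors_apply, cardFactors_apply, Nat.primeFactorsList_add_two, List.length_cons]

/-- `x / minFac x < x` for `x ≥ 2`. -/
private theorem div_minFac_lt' {x : ℕ} (hx : 2 ≤ x) : x / x.minFac < x :=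
  Nat.div_lt_self (by omega) (Nat.minFac_prime (by omega)).one_lt

/-- `1 ≤ x / minFac x` for `x ≥ 1`. -/
private theorem one_le_div_minFac' {x : ℕ} (hx : 1 ≤ x) : 1 ≤ x / x.minFac :=
  Nat.div_pos (Nat.minFac_le (by omega)) (Nat.minFac_pos x)
/-- `2^{Ω(x)} ≤ x` for `x ≥ 1`. -/
private theorem two_pow_cardFactors_le' {x : ℕ} (hx : 1 ≤ x) : 2 ^ Ω x ≤ x := by
  induction x using Nat.strong_induction_on with
  | _ x ih =>
    rcases lt_or_ge x 2 with h | h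
    · have : x = 1 := by omega
      subst this; simp
    · have hlt := div_minFac_lt' h
      have h1 : 1 ≤ x / x.minFac := one_le_div_minFac' hx
      have := ih _ hlt h1
      rw [← cardFactors_div_minFac' h, pow_succ]
      calc 2 ^ Ω (x / x.minFac) * 2 ≤ (x / x.minFac) * x.minFac :=
            Nat.mul_le_mul this (Nat.minFac_prime (by omega)).two_le
        _ = x := Nat.div_mul_cancel (Nat.minFac_dvd x)

/-- `Ω(x) ≤ ⌊log₂ x⌋`. -/
private theorem cardFactors_le_log_two' {x : ℕ} (hx : 1 ≤ x) : Ω x ≤ Nat.log 2 x :=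
  Nat.le_log_of_pow_le (by norm_num) (two_pow_cardFactors_le' hx)

/-- The smallest-prime death is part of the Dirichlet form: for `2 ≤ y`,
`(1/y)·log(minFac y)·(g y − g(y/minFac y))² ≤ (1/y)·Σ_{n ∣ y} Λ(n)(g y − g(y/n))²`. -/
private theorem minFac_term_le_dirichlet_term' (g : ℕ → ℝ) {y : ℕ} (hy : 2 ≤ y) :
    (1 / (y : ℝ)) * (Real.log y.minFac * (g y - g (y / y.minFac)) ^ 2) ≤
      (1 / (y : ℝ)) * ∑ n ∈ y.divisors, (Λ n : ℝ) * (g y - g (y / n)) ^ 2 := by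
  refine mul_le_mul_of_nonneg_left ?_ (by positivity)
  have hp : y.minFac.Prime := Nat.minFac_prime (by omega)
  have hmem : y.minFac ∈ y.divisors := Nat.mem_divisors.2 ⟨Nat.minFac_dvd y, by omega⟩
  have hΛ : (Λ y.minFac : ℝ) = Real.log y.minFac := by
    rw [vonMangoldt_apply_prime hp]
  calc Real.log y.minFac * (g y - g (y / y.minFac)) ^ 2
      = (Λ y.minFac : ℝ) * (g y - g (y / y.minFac)) ^ 2 := by rw [hΛ]
    _ ≤ ∑ n ∈ y.divisors, (Λ n : ℝ) * (g y - g (y / n)) ^ 2 :=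
        Finset.single_le_sum (f := fun n => (Λ n : ℝ) * (g y - g (y / n)) ^ 2)
          (fun n _ => mul_nonneg vonMangoldt_nonneg (sq_nonneg _)) hmem

/-! ### Telescoping along the smallest-prime path, with the exact path -/

/-- A prime `p ≤ N` is `(N+1)`-smooth. -/
theorem prime_mem_smoothNumbers_succ {p N : ℕ} (hp : p.Prime) (hpN : p ≤ N) :
    p ∈ Nat.smoothNumbers (N + 1) := by
  refine ⟨hp.ne_zero, fun q hq => ?_⟩
  rw [Nat.primeFactorsList_prime hp, List.mem_singleton] at hq
  omega

/-- **Telescoping + Cauchy–Schwarz along the smallest-prime path, exact path.**  For `x ≥ 1`: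
`(g x − g 1)² ≤ Ω(x) · Σ_{y ∣ x, y ≥ 2, x/y (minFac y)-smooth} (g y − g(y / minFac y))²`
(`y` is on the path `x → x/minFac x → ⋯ → 1` iff `y ∣ x` and every prime of `x / y` is `≤ minFac y`). -/
theorem sq_sub_le_cardFactors_mul_sum_path (g : ℕ → ℝ) {x : ℕ} (hx : 1 ≤ x) :
    (g x - g 1) ^ 2 ≤
      (Ω x : ℝ) * ∑ y ∈ x.divisors with (2 ≤ y ∧ x / y ∈ Nat.smoothNumbers (y.minFac + 1)),
        (g y - g (y / y.minFac)) ^ 2 := by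
  induction x using Nat.strong_induction_on with
  | _ x ih =>
    rcases lt_or_ge x 2 with h | h
    · have : x = 1 := by omega
      subst this; simp
    · set x' := x / x.minFac with hx'
      have hlt : x' < x := div_minFac_lt' h
      have h1 : 1 ≤ x' := one_le_div_minFac' hx
      have hx0 : x ≠ 0 := by omega
      have hxeq : x = x.minFac * x' := (Nat.mul_div_cancel' (Nat.minFac_dvd x)).symm
      have hΩ : (Ω x : ℝ) = Ω x' + 1 := by
        rw [← cardFactors_div_minFac' h]; push_cast; rfl
      set P : ℕ → ℕ → Prop := fun z y => 2 ≤ y ∧ z / y ∈ Nat.smoothNumbers (y.minFac + 1) with hP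
      set S' := ∑ y ∈ x'.divisors with P x' y, (g y - g (y / y.minFac)) ^ 2 with hS'
      set S := ∑ y ∈ x.divisors with P x y, (g y - g (y / y.minFac)) ^ 2 with hS
      have hIH : (g x' - g 1) ^ 2 ≤ (Ω x' : ℝ) * S' := ih x' hlt h1
      have hS'nn : 0 ≤ S' := Finset.sum_nonneg fun y _ => sq_nonneg _
      have hsub : insert x (x'.divisors.filter (P x')) ⊆ x.divisors.filter (P x) := by
        intro y hy
        rcases Finset.mem_insert.1 hy with rfl | hy
        · refine mem_filter.2 ⟨Nat.mem_divisors_self _ hx0, h, ?_⟩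
          rw [Nat.div_self (by omega)]
          exact ⟨one_ne_zero, fun p hp => by simp [Nat.primeFactorsList_one] at hp⟩
        · obtain ⟨hyd, hy2, hys⟩ := mem_filter.1 hy
          have hyx' : y ∣ x' := (Nat.mem_divisors.1 hyd).1
          refine mem_filter.2 ⟨Nat.mem_divisors.2 ⟨hyx'.trans (Nat.div_dvd_of_dvd (Nat.minFac_dvd x)), hx0⟩,
            hy2, ?_⟩
          have hdiv : x / y = x.minFac * (x' / y) := by
            conv_lhs => rw [hxeq]
            exact Nat.mul_div_assoc _ hyx'
          rw [hdiv]
          refine Nat.mul_mem_smoothNumbers ?_ hys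
          have hmy : y.minFac ∣ x := (Nat.minFac_dvd y).trans (hyx'.trans
            (Nat.div_dvd_of_dvd (Nat.minFac_dvd x)))
          have hle : x.minFac ≤ y.minFac :=
            Nat.minFac_le_of_dvd (Nat.minFac_prime (by omega)).two_le hmy
          exact prime_mem_smoothNumbers_succ (Nat.minFac_prime (by omega)) hle
      have hnot : x ∉ x'.divisors.filter (P x') := by
        intro hm
        have := Nat.divisor_le (mem_filter.1 hm).1
        omega
      have hstep : (g x - g x') ^ 2 + S' ≤ S := by
        have := Finset.sum_le_sum_of_subset_of_nonneg hsub
          (f := fun y => (g y - g (y / y.minFac)) ^ 2) (fun y _ _ => sq_nonneg _)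
        rwa [Finset.sum_insert hnot] at this
      have key : (g x - g 1) ^ 2 ≤ ((Ω x' : ℝ) + 1) * ((g x - g x') ^ 2 + S') := by
        have hn : (0 : ℝ) ≤ Ω x' := Nat.cast_nonneg _
        rcases eq_or_lt_of_le hn with h0 | hpos
        · have hΩ0 : Ω x' = 0 := by exact_mod_cast h0.symm
          have hx'1 : x' = 1 := by
            rcases cardFactors_eq_zero_iff_eq_zero_or_one.1 hΩ0 with h' | h' <;> omega
          have hb0 : g x' - g 1 = 0 := by rw [hx'1, sub_self]
          have hsplit : g x - g 1 = (g x - g x') + (g x' - g 1) := by ring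
          rw [hsplit, hb0, add_zero, ← h0, zero_add, one_mul]
          linarith [hS'nn]
        · set n : ℝ := (Ω x' : ℝ) with hn'
          set a : ℝ := g x - g x'
          set b : ℝ := g x' - g 1
          have hab : g x - g 1 = a + b := by ring
          have hb : b ^ 2 ≤ n * S' := hIH
          have hcs : (a + b) ^ 2 ≤ (1 + n) * a ^ 2 + (1 + 1 / n) * b ^ 2 := by
            have h' : 0 ≤ (n * a - b) ^ 2 / n := div_nonneg (sq_nonneg _) hpos.le
            have hexp : (1 + n) * a ^ 2 + (1 + 1 / n) * b ^ 2 - (a + b) ^ 2 = (n * a - b) ^ 2 / n := by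
              field_simp; ring
            linarith
          have h2 : (1 + 1 / n) * b ^ 2 ≤ (1 + 1 / n) * (n * S') :=
            mul_le_mul_of_nonneg_left hb (by positivity)
          have h3 : (1 + 1 / n) * (n * S') = (n + 1) * S' := by field_simp
          rw [hab]
          nlinarith [hcs, h2, h3, sq_nonneg a]
      calc (g x - g 1) ^ 2 ≤ ((Ω x' : ℝ) + 1) * ((g x - g x') ^ 2 + S') := key
        _ ≤ ((Ω x' : ℝ) + 1) * S := mul_le_mul_of_nonneg_left hstep (by positivity)
        _ = (Ω x : ℝ) * S := by rw [hΩ]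

/-! ### Harmonic mass of smooth numbers: the finite Euler product -/

/-- **Euler product bound for the harmonic mass of smooth numbers**:
`Σ_{m ≤ X, m N-smooth} 1/m ≤ ∏_{p < N} (1 − 1/p)⁻¹` (the completely multiplicative `n ↦ 1/n` summed over the
`N`-smooth numbers IS the finite Euler product). -/
theorem sum_inv_smooth_le_prod (N X : ℕ) :
    ∑ m ∈ (Icc 1 X).filter (· ∈ Nat.smoothNumbers N), (1 : ℝ) / m ≤
      ∏ p ∈ N.primesBelow, (1 - 1 / (p : ℝ))⁻¹ := by
  let f : ℕ →* ℝ :=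
    { toFun := fun n => (n : ℝ)⁻¹
      map_one' := by simp
      map_mul' := fun m n => by push_cast; rw [mul_inv] }
  have hf : ∀ n : ℕ, f n = (n : ℝ)⁻¹ := fun _ => rfl
  have hlt : ∀ {p : ℕ}, p.Prime → ‖f p‖ < 1 := by
    intro p hp
    rw [hf, Real.norm_eq_abs, abs_of_nonneg (by positivity)]
    exact inv_lt_one_of_one_lt₀ (by exact_mod_cast hp.one_lt)
  obtain ⟨-, hsum⟩ := EulerProduct.summable_and_hasSum_smoothNumbers_prod_primesBelow_geometric hlt N
  have hind : HasSum ((Nat.smoothNumbers N).indicator (fun n : ℕ => (f n : ℝ)))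
      (∏ p ∈ N.primesBelow, (1 - f p)⁻¹) := hasSum_subtype_iff_indicator.1 hsum
  have hnn : ∀ n, 0 ≤ (Nat.smoothNumbers N).indicator (fun n : ℕ => (f n : ℝ)) n := by
    intro n
    by_cases hn : n ∈ Nat.smoothNumbers N
    · rw [Set.indicator_of_mem hn, hf]; positivity
    · rw [Set.indicator_of_notMem hn]
  have hle := sum_le_hasSum (Icc 1 X) (fun n _ => hnn n) hind
  have hlhs : ∑ m ∈ (Icc 1 X).filter (· ∈ Nat.smoothNumbers N), (1 : ℝ) / m =
      ∑ n ∈ Icc 1 X, (Nat.smoothNumbers N).indicator (fun n : ℕ => (f n : ℝ)) n := by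
    rw [Finset.sum_filter]
    refine Finset.sum_congr rfl fun n _ => ?_
    by_cases hn : n ∈ Nat.smoothNumbers N
    · rw [if_pos hn, Set.indicator_of_mem hn, hf, one_div]
    · rw [if_neg hn, Set.indicator_of_notMem hn]
  have hrhs : ∏ p ∈ N.primesBelow, (1 - f p)⁻¹ = ∏ p ∈ N.primesBelow, (1 - 1 / (p : ℝ))⁻¹ :=
    Finset.prod_congr rfl fun p _ => by rw [hf, one_div]
  rw [hlhs, ← hrhs]
  exact hle

/-- The finite Euler product is `≥ 1` (the case `X = 1` of `sum_inv_smooth_le_prod`). -/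
theorem one_le_prod_primesBelow_inv (N : ℕ) : 1 ≤ ∏ p ∈ N.primesBelow, (1 - 1 / (p : ℝ))⁻¹ := by
  have h := sum_inv_smooth_le_prod N 1
  have h1 : 1 ∈ Nat.smoothNumbers N := ⟨one_ne_zero, fun p hp => by simp [Nat.primeFactorsList_one] at hp⟩
  rwa [Finset.Icc_self, Finset.filter_singleton, if_pos h1, Finset.sum_singleton, Nat.cast_one, div_one] at h

/-! ### Harmonic mass of the users of an edge of the smallest-prime tree -/

/-- **The users of the edge `y → y / minFac y` weigh at most `(1/y) ∏_{q ≤ minFac y}(1 − 1/q)⁻¹`**: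
`Σ_{x ≤ M : y ∣ x, x/y (minFac y)-smooth} 1/x ≤ (1/y) · ∏_{q ∈ primesBelow (minFac y + 1)} (1 − 1/q)⁻¹`
(`y ≥ 1`). -/
theorem sum_inv_path_users_le {M y : ℕ} (hy : 1 ≤ y) :
    ∑ x ∈ (Icc 1 M).filter (fun x => y ∣ x ∧ x / y ∈ Nat.smoothNumbers (y.minFac + 1)), (1 : ℝ) / x ≤
      (1 / (y : ℝ)) * ∏ q ∈ (y.minFac + 1).primesBelow, (1 - 1 / (q : ℝ))⁻¹ := by
  have hy0 : y ≠ 0 := by omega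
  set N := y.minFac + 1 with hN
  have hset : (Icc 1 M).filter (fun x => y ∣ x ∧ x / y ∈ Nat.smoothNumbers N) =
      ((Icc 1 (M / y)).filter (· ∈ Nat.smoothNumbers N)).map ⟨fun m => y * m, mul_right_injective₀ hy0⟩ := by
    ext x
    simp only [mem_filter, mem_Icc, mem_map, Function.Embedding.coeFn_mk]
    constructor
    · rintro ⟨⟨h1, h2⟩, ⟨m, rfl⟩, hs⟩
      rw [Nat.mul_div_cancel_left _ (by omega)] at hs
      refine ⟨m, ⟨⟨?_, ?_⟩, hs⟩, rfl⟩
      · rcases Nat.eq_zero_or_pos m with h | h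
        · subst h; simp at h1
        · exact h
      · exact (Nat.le_div_iff_mul_le hy).2 (by rw [mul_comm]; exact h2)
    · rintro ⟨m, ⟨⟨h1, h2⟩, hs⟩, rfl⟩
      refine ⟨⟨?_, ?_⟩, dvd_mul_right y m, ?_⟩
      · exact Nat.one_le_iff_ne_zero.2 (Nat.mul_ne_zero hy0 (by omega))
      · have := (Nat.le_div_iff_mul_le hy).1 h2
        rwa [mul_comm] at this
      · rwa [Nat.mul_div_cancel_left _ (by omega)]
  rw [hset, sum_map]
  simp only [Function.Embedding.coeFn_mk]
  have hre : ∑ m ∈ (Icc 1 (M / y)).filter (· ∈ Nat.smoothNumbers N), (1 : ℝ) / ((y * m : ℕ) : ℝ) =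
      (1 / (y : ℝ)) * ∑ m ∈ (Icc 1 (M / y)).filter (· ∈ Nat.smoothNumbers N), (1 : ℝ) / m := by
    rw [Finset.mul_sum]
    refine Finset.sum_congr rfl fun m _ => ?_
    push_cast
    rw [one_div_mul_one_div]
  rw [hre]
  exact mul_le_mul_of_nonneg_left (sum_inv_smooth_le_prod N (M / y)) (by positivity)

/-! ### PROPOSITION 24.7: the `1/L` Poincaré inequality -/

/-- **PROP. 24.7 (tree form).**  For every `M` and `g`:
`Σ_{x ≤ M} (1/x)(g x − g 1)² ≤ ⌊log₂ M⌋ · Σ_{2 ≤ y ≤ M} (∏_{q ≤ minFac y}(1 − 1/q)⁻¹) · (1/y)(g y − g(y/minFac y))²`. -/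
theorem walk_poincare_mertens (M : ℕ) (g : ℕ → ℝ) :
    ∑ x ∈ Icc 1 M, (1 / (x : ℝ)) * (g x - g 1) ^ 2 ≤
      (Nat.log 2 M : ℝ) * ∑ y ∈ Icc 2 M, (∏ q ∈ (y.minFac + 1).primesBelow, (1 - 1 / (q : ℝ))⁻¹) *
        ((1 / (y : ℝ)) * (g y - g (y / y.minFac)) ^ 2) := by
  set e : ℕ → ℝ := fun y => (g y - g (y / y.minFac)) ^ 2 with he
  set π : ℕ → ℝ := fun y => ∏ q ∈ (y.minFac + 1).primesBelow, (1 - 1 / (q : ℝ))⁻¹ with hπ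
  have he0 : ∀ y, 0 ≤ e y := fun y => sq_nonneg _
  set P : ℕ → ℕ → Prop := fun x y => 2 ≤ y ∧ x / y ∈ Nat.smoothNumbers (y.minFac + 1) with hP
  have h1 : ∑ x ∈ Icc 1 M, (1 / (x : ℝ)) * (g x - g 1) ^ 2 ≤
      ∑ x ∈ Icc 1 M, (Nat.log 2 M : ℝ) * ((1 / (x : ℝ)) * ∑ y ∈ x.divisors with P x y, e y) := by
    refine Finset.sum_le_sum fun x hx => ?_
    have hx1 : 1 ≤ x := (mem_Icc.1 hx).1
    have hΩ : (Ω x : ℝ) ≤ Nat.log 2 M := by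
      exact_mod_cast (cardFactors_le_log_two' hx1).trans (Nat.log_mono_right (mem_Icc.1 hx).2)
    have hSnn : 0 ≤ ∑ y ∈ x.divisors with P x y, e y := Finset.sum_nonneg fun y _ => he0 y
    calc (1 / (x : ℝ)) * (g x - g 1) ^ 2 ≤ (1 / (x : ℝ)) * ((Ω x : ℝ) * ∑ y ∈ x.divisors with P x y, e y) :=
          mul_le_mul_of_nonneg_left (sq_sub_le_cardFactors_mul_sum_path g hx1) (by positivity)
      _ ≤ (1 / (x : ℝ)) * ((Nat.log 2 M : ℝ) * ∑ y ∈ x.divisors with P x y, e y) :=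
          mul_le_mul_of_nonneg_left (mul_le_mul_of_nonneg_right hΩ hSnn) (by positivity)
      _ = _ := by ring
  have hcomm : ∑ x ∈ Icc 1 M, ((1 / (x : ℝ)) * ∑ y ∈ x.divisors with P x y, e y) =
      ∑ y ∈ Icc 2 M, e y * ∑ x ∈ (Icc 1 M).filter
        (fun x => y ∣ x ∧ x / y ∈ Nat.smoothNumbers (y.minFac + 1)), (1 / (x : ℝ)) := by
    simp_rw [Finset.mul_sum]
    refine (Finset.sum_comm' (s := Icc 1 M) (t := fun x => x.divisors.filter (P x))
      (t' := Icc 2 M) (s' := fun y => (Icc 1 M).filter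
        (fun x => y ∣ x ∧ x / y ∈ Nat.smoothNumbers (y.minFac + 1)))
      (f := fun x y => (1 / (x : ℝ)) * e y) ?_).trans ?_
    · intro x y
      simp only [mem_Icc, mem_filter, Nat.mem_divisors, hP]
      constructor
      · rintro ⟨⟨hx1, hxM⟩, ⟨hyx, hx0⟩, hy2, hys⟩
        exact ⟨⟨⟨hx1, hxM⟩, hyx, hys⟩, hy2, (Nat.le_of_dvd (by omega) hyx).trans hxM⟩
      · rintro ⟨⟨⟨hx1, hxM⟩, hyx, hys⟩, hy2, hyM⟩
        exact ⟨⟨hx1, hxM⟩, ⟨hyx, by omega⟩, hy2, hys⟩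
    · exact Finset.sum_congr rfl fun y _ => Finset.sum_congr rfl fun x _ => mul_comm _ _
  have h3 : ∑ y ∈ Icc 2 M, e y * ∑ x ∈ (Icc 1 M).filter
        (fun x => y ∣ x ∧ x / y ∈ Nat.smoothNumbers (y.minFac + 1)), (1 / (x : ℝ)) ≤
      ∑ y ∈ Icc 2 M, e y * ((1 / (y : ℝ)) * π y) := by
    refine Finset.sum_le_sum fun y hy => mul_le_mul_of_nonneg_left ?_ (he0 y)
    exact sum_inv_path_users_le (by have := (mem_Icc.1 hy).1; omega)
  calc ∑ x ∈ Icc 1 M, (1 / (x : ℝ)) * (g x - g 1) ^ 2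
      ≤ ∑ x ∈ Icc 1 M, (Nat.log 2 M : ℝ) * ((1 / (x : ℝ)) * ∑ y ∈ x.divisors with P x y, e y) := h1
    _ = (Nat.log 2 M : ℝ) * ∑ y ∈ Icc 2 M, e y * ∑ x ∈ (Icc 1 M).filter
          (fun x => y ∣ x ∧ x / y ∈ Nat.smoothNumbers (y.minFac + 1)), (1 / (x : ℝ)) := by
        rw [← Finset.mul_sum, hcomm]
    _ ≤ (Nat.log 2 M : ℝ) * ∑ y ∈ Icc 2 M, e y * ((1 / (y : ℝ)) * π y) :=
        mul_le_mul_of_nonneg_left h3 (Nat.cast_nonneg _)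
    _ = (Nat.log 2 M : ℝ) * ∑ y ∈ Icc 2 M, π y * ((1 / (y : ℝ)) * (g y - g (y / y.minFac)) ^ 2) := by
        congr 1
        refine Finset.sum_congr rfl fun y _ => ?_
        simp only [he]
        ring

/-- **PROP. 24.7 (Dirichlet-form version, Mertens constant as a hypothesis).**  If
`∏_{q ≤ p}(1 − 1/q)⁻¹ ≤ C · log p` for every prime `p ≤ M` (Mertens' product theorem; the smallest
admissible constant is `2/log 2`, attained at `p = 2`), then with
`D(g) = Σ_{x ≤ M} (1/x) Σ_{n ∣ x} Λ(n)(g x − g(x/n))²` (the unnormalised t-time Dirichlet form of the walk)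
`Σ_{x ≤ M} (1/x)(g x − g 1)² ≤ ⌊log₂ M⌋ · C · D(g)`; hence every non-zero eigenvalue of `−ℒ_M` is
`≥ 1/(C ⌊log₂ M⌋)` in t-units. -/
theorem walk_poincare_mertens_dirichlet (M : ℕ) (g : ℕ → ℝ) {C : ℝ}
    (hC : ∀ p : ℕ, p.Prime → p ≤ M →
      ∏ q ∈ (p + 1).primesBelow, (1 - 1 / (q : ℝ))⁻¹ ≤ C * Real.log p) :
    ∑ x ∈ Icc 1 M, (1 / (x : ℝ)) * (g x - g 1) ^ 2 ≤
      (Nat.log 2 M : ℝ) * C *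
        ∑ x ∈ Icc 1 M, (1 / (x : ℝ)) * ∑ n ∈ x.divisors, (Λ n : ℝ) * (g x - g (x / n)) ^ 2 := by
  rcases lt_or_ge M 2 with hM | hM
  · have hL : ∑ x ∈ Icc 1 M, (1 / (x : ℝ)) * (g x - g 1) ^ 2 = 0 := Finset.sum_eq_zero fun x hx => by
      obtain rfl : x = 1 := by have := mem_Icc.1 hx; omega
      simp
    rw [hL, Nat.log_of_lt hM]; simp
  have hCnn : 0 ≤ C := by
    have h1 : (1 : ℝ) ≤ ∏ q ∈ Nat.primesBelow (2 + 1), (1 - 1 / (q : ℝ))⁻¹ := one_le_prod_primesBelow_inv _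
    nlinarith [hC 2 Nat.prime_two hM, Real.log_pos (show (1 : ℝ) < 2 by norm_num)]
  have htree : ∑ y ∈ Icc 2 M, (∏ q ∈ (y.minFac + 1).primesBelow, (1 - 1 / (q : ℝ))⁻¹) *
        ((1 / (y : ℝ)) * (g y - g (y / y.minFac)) ^ 2) ≤
      C * ∑ x ∈ Icc 1 M, (1 / (x : ℝ)) * ∑ n ∈ x.divisors, (Λ n : ℝ) * (g x - g (x / n)) ^ 2 := by
    rw [Finset.mul_sum]
    have hsub : Icc 2 M ⊆ Icc 1 M := Finset.Icc_subset_Icc_left (by norm_num)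
    refine le_trans (Finset.sum_le_sum fun y hy => ?_)
      (Finset.sum_le_sum_of_subset_of_nonneg hsub fun x _ _ =>
        mul_nonneg hCnn (mul_nonneg (by positivity)
          (Finset.sum_nonneg fun n _ => mul_nonneg vonMangoldt_nonneg (sq_nonneg _))))
    have hy2 : 2 ≤ y := (mem_Icc.1 hy).1
    have hyM : y ≤ M := (mem_Icc.1 hy).2
    have hpr : y.minFac.Prime := Nat.minFac_prime (by omega)
    have hπ : ∏ q ∈ (y.minFac + 1).primesBelow, (1 - 1 / (q : ℝ))⁻¹ ≤ C * Real.log y.minFac :=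
      hC _ hpr ((Nat.minFac_le (by omega)).trans hyM)
    calc (∏ q ∈ (y.minFac + 1).primesBelow, (1 - 1 / (q : ℝ))⁻¹) * ((1 / (y : ℝ)) * (g y - g (y / y.minFac)) ^ 2)
        ≤ (C * Real.log y.minFac) * ((1 / (y : ℝ)) * (g y - g (y / y.minFac)) ^ 2) :=
          mul_le_mul_of_nonneg_right hπ (by positivity)
      _ = C * ((1 / (y : ℝ)) * (Real.log y.minFac * (g y - g (y / y.minFac)) ^ 2)) := by ring
      _ ≤ C * ((1 / (y : ℝ)) * ∑ n ∈ y.divisors, (Λ n : ℝ) * (g y - g (y / n)) ^ 2) :=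
          mul_le_mul_of_nonneg_left (minFac_term_le_dirichlet_term' g hy2) hCnn
  calc ∑ x ∈ Icc 1 M, (1 / (x : ℝ)) * (g x - g 1) ^ 2
      ≤ (Nat.log 2 M : ℝ) * ∑ y ∈ Icc 2 M, (∏ q ∈ (y.minFac + 1).primesBelow, (1 - 1 / (q : ℝ))⁻¹) *
          ((1 / (y : ℝ)) * (g y - g (y / y.minFac)) ^ 2) := walk_poincare_mertens M g
    _ ≤ (Nat.log 2 M : ℝ) * (C * ∑ x ∈ Icc 1 M, (1 / (x : ℝ)) *
          ∑ n ∈ x.divisors, (Λ n : ℝ) * (g x - g (x / n)) ^ 2) :=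
        mul_le_mul_of_nonneg_left htree (Nat.cast_nonneg _)
    _ = _ := by ring

/-- The tree's elementary Mertens bound in Euler-product form: for a prime `p`,
`∏_{q ≤ p} (1 − 1/q)⁻¹ ≤ e⁵ · log p`
(`Literature.NumberTheory.LFunctions.MertensBound.exp_neg_div_log_le_prod_one_sub_inv`). -/
theorem prod_primesBelow_inv_le_exp_five_mul_log {p : ℕ} (hp : p.Prime) :
    ∏ q ∈ (p + 1).primesBelow, (1 - 1 / (q : ℝ))⁻¹ ≤ Real.exp 5 * Real.log p := by
  have hp2 : 2 ≤ p := hp.two_le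
  have hlog : 0 < Real.log p := Real.log_pos (by exact_mod_cast hp.one_lt)
  have h : Real.exp (-5) / Real.log p ≤ ∏ q ∈ (p + 1).primesBelow, (1 - 1 / (q : ℝ)) :=
    Literature.NumberTheory.LFunctions.MertensBound.exp_neg_div_log_le_prod_one_sub_inv p hp2
  have hpos : 0 < ∏ q ∈ (p + 1).primesBelow, (1 - 1 / (q : ℝ)) := by
    refine Finset.prod_pos fun q hq => ?_
    have hq1 : (1 : ℝ) < q := by exact_mod_cast (Nat.mem_primesBelow.1 hq).2.one_lt
    rw [sub_pos, div_lt_one (by linarith)]; exact hq1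
  rw [Finset.prod_inv_distrib]
  calc (∏ q ∈ (p + 1).primesBelow, (1 - 1 / (q : ℝ)))⁻¹ ≤ (Real.exp (-5) / Real.log p)⁻¹ :=
        (inv_le_inv₀ hpos (div_pos (Real.exp_pos _) hlog)).2 h
    _ = Real.exp 5 * Real.log p := by rw [inv_div, Real.exp_neg, div_inv_eq_mul, mul_comm]

/-- **PROP. 24.7, unconditional with the explicit constant `e⁵`.**  For every `M` and `g`:
`Σ_{x ≤ M} (1/x)(g x − g 1)² ≤ e⁵ ⌊log₂ M⌋ · D(g)`; hence every non-zero eigenvalue of `−ℒ_M` is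
`≥ e^{−5}/⌊log₂ M⌋ ≥ e^{−5} log 2 / log M` in t-units — the first `1/L` lower bound in the kernel
(`walk_poincare_weak_dirichlet` gave `log 2/(⌊log₂M⌋(1 + log M))`). -/
theorem walk_poincare_mertens_dirichlet_exp_five (M : ℕ) (g : ℕ → ℝ) :
    ∑ x ∈ Icc 1 M, (1 / (x : ℝ)) * (g x - g 1) ^ 2 ≤
      (Nat.log 2 M : ℝ) * Real.exp 5 *
        ∑ x ∈ Icc 1 M, (1 / (x : ℝ)) * ∑ n ∈ x.divisors, (Λ n : ℝ) * (g x - g (x / n)) ^ 2 :=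
  walk_poincare_mertens_dirichlet M g fun _ hp _ => prod_primesBelow_inv_le_exp_five_mul_log hp

/-- The harmonic mass of the `(p+1)`-smooth numbers is `≤ e⁵·log p` (`p` prime; the mass of an atom `𝒜(p, ·)`). -/
theorem sum_inv_smooth_le_exp_five_mul_log {p : ℕ} (hp : p.Prime) (X : ℕ) :
    ∑ m ∈ (Icc 1 X).filter (· ∈ Nat.smoothNumbers (p + 1)), (1 : ℝ) / m ≤ Real.exp 5 * Real.log p :=
  (sum_inv_smooth_le_prod (p + 1) X).trans (prod_primesBelow_inv_le_exp_five_mul_log hp)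
end Summit.RiemannHypothesis.RiemannHypothesis.Theorems.IntegerScrew

end
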